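import Summits.CriticalPhenomena.PercolationContinuityZ3.Theorems.PercNearOneGluingNoHeavyLowerTailFKCSHPeel
import Summits.CriticalPhenomena.PercolationContinuityZ3.Theorems.PercNearOneGluingNoHeavyLowerTailKNConj4PreMargin
import HarnessLib

/-!
# FK sub-lane: Kozma–Nitzan's pre-FKG Conjecture 4 under a general measure — the pre-FKG surplus peeling from the conditioned
# slack hierarchy (measure-parametrised)

Support file (`--supports stmt-CriticalPhenomena-4575`), FK sub-lane `prim-bschramm-fk-2` (gen 5) of the post-continuity programme;
builds on p205010 (kernel theorem, internal audit signed; external expert review pending).  No definitions, no named facts, no sorries;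
standard axioms.  Line-by-line port of prim-ineq-gen-6's `PreFKGSurplus.preSurplus_erase_add` / `PreFKGSurplus.preMargin_nonneg_of_csh`
(`…NoHeavyLowerTailKNConj4PreMargin.lean`) from `prodBernoulli w` to an arbitrary probability measure `μ` with full support on the bond
configurations of `Fin n`, in the vocabulary of fk-1's measure-parametrised CSH (`FK.CSHHoldsFor`, `FK.covDμ`, `FK.decoyListμ`, `FK.obsConstμ`,
`FK.avoidConstμ`; template `FK.s5dMarginμ_nonneg_of_cshFor`).

Kozma–Nitzan, arXiv:2401.12397, CONJECTURE 4 (p. 32): for every monotone cluster property `f(v,ω) = F(C_ω(v))`, every relay set `A` and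
every `0`, `E[f(0); 0 ↔ A] ≥ min_{a∈A} E[f(a); 0 ↔ A]`.  The only input of the `q = 1` peeling that is NOT measure-generic is the
projection step (vdBHK Lemma 2.4: on `{k ↮ c}`, `E[F(C(c)) | C_k = K]` is a DECREASING function `g(K)` of the edge cluster of `k`); here
it is the hypothesis `htower` (for `φ_{w,q}`, `q ≥ 1`, it is fk-2 g5's `FK.tower_clusterFun_rc` + `FK.antitone_condMean_rc`,
`…FKKNConj4Tower.lean`).

* `FK.preSurplusμ_erase_add` — peeling a relay off the pre-FKG surplus `Δ_u(X) = ∫_{u↔X} (F(C u) − F(C c)) dμ` (pure measure theory);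
* `FK.preMarginμ_nonneg_of_cshFor` — (pS5D) under `μ`: IF `FK.CSHHoldsFor μ` for every owner / avoided set / decoy list (named vertices
  distinct), `μ` has full support, and the projection hypothesis holds, THEN for every relay set `X`, every `c ∈ X` of least mean, every
  decoy list `D` and every monotone `F`: `0 ≤ Marg_{X,D}[u ↦ Δ_u(X)]`.
[cite: KozmaNitzan2024, Conj. 4 and Thms. 7–9 (p. 32)] [cite: VandenbergHaggstromKahn2005, Thm. 1.3 (p. 6), §2.1 Lemma 2.4 (p. 10)]
-/

noncomputable section

namespace Summit.CriticalPhenomena.PercolationContinuityZ3.Theorems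

open MeasureTheory Set Literature.Probability.LatticeModels Literature.Probability.Percolation
open scoped Classical
open KNPreFKG

namespace FK

variable {n : ℕ}

/-- **Peeling an arbitrary relay off the pre-FKG surplus, under any finite measure.**  For `k ∈ X` and every `u`:
`Δ_u(X) = Δ_u(X.erase k) + ∫_{{k ↮ X.erase k} ∩ {k ↔ u}} (F(C k) − F(C c)) dμ` (on the new part `C(u) = C(k)`).
(port of `PreFKGSurplus.preSurplus_erase_add`) [cite: KozmaNitzan2024, Conj. 4 (p. 32)] -/
theorem preSurplusμ_erase_add (μ : Measure (BondConfig (Fin n))) [IsFiniteMeasure μ] (X : Finset (Fin n)) (F : Set (Fin n) → ℝ)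
    (c k u : Fin n) (hkX : k ∈ X) :
    ∫ ω in ⋃ a ∈ X, openConn u a, (F (openCluster ω u) - F (openCluster ω c)) ∂μ =
      (∫ ω in ⋃ a ∈ X.erase k, openConn u a, (F (openCluster ω u) - F (openCluster ω c)) ∂μ) +
        ∫ ω in {ω : BondConfig (Fin n) | ∀ a ∈ (↑(X.erase k) : Set (Fin n)), ¬ (openGraph ω).Reachable k a} ∩ openConn k u,
          (F (openCluster ω k) - F (openCluster ω c)) ∂μ := by
  classical
  have hmeas : ∀ S : Set (BondConfig (Fin n)), MeasurableSet S := fun _ => MeasurableSet.of_discrete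
  have hint : ∀ (g : BondConfig (Fin n) → ℝ), Integrable g μ := fun g => Integrable.of_finite
  set gu : BondConfig (Fin n) → ℝ := fun ω => F (openCluster ω u) - F (openCluster ω c) with hgu
  set gk : BondConfig (Fin n) → ℝ := fun ω => F (openCluster ω k) - F (openCluster ω c) with hgk
  set Dk : Set (BondConfig (Fin n)) := {ω : BondConfig (Fin n) | ∀ a ∈ (↑(X.erase k) : Set (Fin n)), ¬ (openGraph ω).Reachable k a}
    with hDk
  have hpt : ∀ ω : BondConfig (Fin n), (⋃ a ∈ X, (openConn u a : Set (BondConfig (Fin n)))).indicator gu ω =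
      (⋃ a ∈ X.erase k, (openConn u a : Set (BondConfig (Fin n)))).indicator gu ω + (Dk ∩ openConn k u).indicator gk ω := by
    intro ω
    by_cases h1 : ∃ a ∈ X.erase k, (openGraph ω).Reachable u a
    · obtain ⟨a, ha, hua⟩ := h1
      have m1 : ω ∈ ⋃ a ∈ X, (openConn u a : Set (BondConfig (Fin n))) :=
        (PreFKGSurplus.mem_iUnion_openConn X u ω).2 ⟨a, Finset.mem_of_mem_erase ha, hua⟩
      have m2 : ω ∈ ⋃ a ∈ X.erase k, (openConn u a : Set (BondConfig (Fin n))) :=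
        (PreFKGSurplus.mem_iUnion_openConn _ u ω).2 ⟨a, ha, hua⟩
      have m3 : ω ∉ Dk ∩ openConn k u := fun h => h.1 a (Finset.mem_coe.2 ha) ((show (openGraph ω).Reachable k u from h.2).trans hua)
      rw [indicator_of_mem m1, indicator_of_mem m2, indicator_of_notMem m3, add_zero]
    · by_cases h2 : (openGraph ω).Reachable u k
      · have m1 : ω ∈ ⋃ a ∈ X, (openConn u a : Set (BondConfig (Fin n))) := (PreFKGSurplus.mem_iUnion_openConn X u ω).2 ⟨k, hkX, h2⟩
        have m2 : ω ∉ ⋃ a ∈ X.erase k, (openConn u a : Set (BondConfig (Fin n))) :=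
          fun h => h1 ((PreFKGSurplus.mem_iUnion_openConn _ u ω).1 h)
        have m3 : ω ∈ Dk ∩ openConn k u := by
          refine ⟨fun a ha hka => h1 ⟨a, Finset.mem_coe.1 ha, h2.trans hka⟩, ?_⟩
          exact (show (openGraph ω).Reachable k u from h2.symm)
        rw [indicator_of_mem m1, indicator_of_notMem m2, indicator_of_mem m3, zero_add, hgu, hgk]
        simp only [PreFKGSurplus.openCluster_eq_of_reach h2]
      · have m1 : ω ∉ ⋃ a ∈ X, (openConn u a : Set (BondConfig (Fin n))) := by
          intro h
          obtain ⟨a, ha, hua⟩ := (PreFKGSurplus.mem_iUnion_openConn X u ω).1 h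
          by_cases hak : a = k
          · exact h2 (hak ▸ hua)
          · exact h1 ⟨a, Finset.mem_erase.2 ⟨hak, ha⟩, hua⟩
        have m2 : ω ∉ ⋃ a ∈ X.erase k, (openConn u a : Set (BondConfig (Fin n))) :=
          fun h => h1 ((PreFKGSurplus.mem_iUnion_openConn _ u ω).1 h)
        have m3 : ω ∉ Dk ∩ openConn k u := fun h => h2 (show (openGraph ω).Reachable k u from h.2).symm
        rw [indicator_of_notMem m1, indicator_of_notMem m2, indicator_of_notMem m3, add_zero]
  rw [← integral_indicator (hmeas _), ← integral_indicator (hmeas _), ← integral_indicator (hmeas _),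
    ← integral_add (hint _) (hint _)]
  exact integral_congr_ae (Filter.Eventually.of_forall hpt)

/-- **(pS5D) under a general measure — the pre-FKG surplus margin is nonnegative.**  `μ` a probability measure on the bond configurations of
`Fin n` with full support; observers `o, v`; `hCSH` = the conditioned slack hierarchy under `μ` for every owner / avoided set / decoy list with
the named vertices distinct (as in `FK.s5dMarginμ_nonneg_of_cshFor`); `htower` = the projection hypothesis: for every benchmark `c`, owner `k`
and monotone `F` there is a DECREASING `g` on edge sets with `∫ F(C(c)) dμ = ∫ g(C_k) dμ` on every `σ(C_k)`-event inside `{k ↮ c}` (vdBHK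
Lemma 2.4; for `φ_{w,q}` see `FK.tower_clusterFun_rc`).  Then for every relay set `X`, every `c ∈ X` with `E F(C c) ≤ E F(C a)` for all
`a ∈ X`, every decoy list `D` and every monotone `F`:  `0 ≤ Marg_{X,D}[u ↦ ∫_{u↔X} (F(C u) − F(C c)) dμ]`.
Proof = `PreFKGSurplus.preMargin_nonneg_of_csh` line by line (peel any `k ≠ c`; the peeled term is the one-cluster quantity of the MONOTONE
projected functional `G_k(K) = F(span K) − g(K)`; `∫_{D_k} G_k = (m_k − m_c) − Δ_k(X∖k) ≥ −Δ_k(X∖k)` replaces Lemma κ; Lemma AC from CSH at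
`Ψ_iso`; strong induction on `|X|`). (port of `PreFKGSurplus.preMargin_nonneg_of_csh`, measure-parametrised)
[cite: KozmaNitzan2024, Conj. 4 (p. 32)] [cite: VandenbergHaggstromKahn2005, §2.1 Lemma 2.4 (p. 10)] -/
theorem preMarginμ_nonneg_of_cshFor (μ : Measure (BondConfig (Fin n))) [IsProbabilityMeasure μ]
    (hfull : ∀ S : Set (BondConfig (Fin n)), S.Nonempty → 0 < μ.real S) (o v : Fin n)
    (hCSH : ∀ (x : Fin n) (Y : Finset (Fin n)) (D : List (Fin n)),
      x ∉ Y → o ≠ x → v ≠ x → o ∉ Y → v ∉ Y → D.Nodup → (∀ d ∈ D, d ≠ x ∧ d ∉ Y ∧ d ≠ o ∧ d ≠ v) →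
      CSHHoldsFor μ x (↑Y : Set (Fin n)) D o v)
    (htower : ∀ (c k : Fin n) (F : Set (Fin n) → ℝ), (∀ S S' : Set (Fin n), S ⊆ S' → F S ≤ F S') →
      ∃ g : Set (Sym2 (Fin n)) → ℝ, Antitone g ∧ ∀ 𝒮 : Set (Set (Sym2 (Fin n))),
        ∫ ω in {ω : BondConfig (Fin n) | ¬ (openGraph ω).Reachable k c} ∩ {ω | openEdgeCluster ω k ∈ 𝒮}, F (openCluster ω c) ∂μ =
          ∫ ω in {ω : BondConfig (Fin n) | ¬ (openGraph ω).Reachable k c} ∩ {ω | openEdgeCluster ω k ∈ 𝒮}, g (openEdgeCluster ω k) ∂μ) :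
    ∀ (X : Finset (Fin n)) (c : Fin n) (D : List (Fin n)) (F : Set (Fin n) → ℝ),
      (∀ S S' : Set (Fin n), S ⊆ S' → F S ≤ F S') → c ∈ X →
      (∀ a ∈ X, ∫ ω, F (openCluster ω c) ∂μ ≤ ∫ ω, F (openCluster ω a) ∂μ) →
      o ∉ X → v ∉ X → D.Nodup → (∀ d ∈ D, d ∉ X ∧ d ≠ o ∧ d ≠ v) →
      0 ≤ CSH.cshMarg (decoyListμ μ (↑X : Set (Fin n)) D) (obsConstμ μ o v ((↑X : Set (Fin n)) ∪ {d | d ∈ D})) o v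
        (fun u => ∫ ω in ⋃ a ∈ X, openConn u a, (F (openCluster ω u) - F (openCluster ω c)) ∂μ) := by
  classical
  have main : ∀ (N : ℕ) (X : Finset (Fin n)) (c : Fin n) (D : List (Fin n)) (F : Set (Fin n) → ℝ), X.card = N →
      (∀ S S' : Set (Fin n), S ⊆ S' → F S ≤ F S') → c ∈ X →
      (∀ a ∈ X, ∫ ω, F (openCluster ω c) ∂μ ≤ ∫ ω, F (openCluster ω a) ∂μ) →
      o ∉ X → v ∉ X → D.Nodup → (∀ d ∈ D, d ∉ X ∧ d ≠ o ∧ d ≠ v) →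
      0 ≤ CSH.cshMarg (decoyListμ μ (↑X : Set (Fin n)) D) (obsConstμ μ o v ((↑X : Set (Fin n)) ∪ {d | d ∈ D})) o v
        (fun u => ∫ ω in ⋃ a ∈ X, openConn u a, (F (openCluster ω u) - F (openCluster ω c)) ∂μ) := by
    intro N
    induction N using Nat.strong_induction_on with
    | _ N ih =>
    intro X c D F hN hF hcX hcmin hoX hvX hD hDX
    have hmeas : ∀ S : Set (BondConfig (Fin n)), MeasurableSet S := fun _ => MeasurableSet.of_discrete
    have hint : ∀ (g : BondConfig (Fin n) → ℝ), Integrable g μ := fun g => Integrable.of_finite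
    have hn := fun (S : Set (BondConfig (Fin n))) => (measureReal_nonneg : 0 ≤ μ.real S)
    have hoc : o ≠ c := fun h => hoX (h ▸ hcX)
    have hvc : v ≠ c := fun h => hvX (h ▸ hcX)
    -- the pre-FKG surplus as a function of the relay set
    set PS : Finset (Fin n) → (Fin n → ℝ) := fun Y u =>
      ∫ ω in ⋃ a ∈ Y, openConn u a, (F (openCluster ω u) - F (openCluster ω c)) ∂μ with hPS
    rcases (X.erase c).eq_empty_or_nonempty with h0 | hne
    · -- base: `X = {c}`, `Δ ≡ 0`
      have hXc : X = {c} := by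
        rw [← Finset.insert_erase hcX, h0]; rfl
      have hzero : PS X = fun _ => 0 := by
        funext u
        simp only [hPS, hXc]
        have hU : (⋃ a ∈ ({c} : Finset (Fin n)), (openConn u a : Set (BondConfig (Fin n)))) = openConn u c := by
          ext ω; simp
        rw [hU]
        rw [setIntegral_congr_fun (hmeas _) (g := fun _ => (0 : ℝ)) (fun ω hω => by
          show F (openCluster ω u) - F (openCluster ω c) = 0
          rw [PreFKGSurplus.openCluster_eq_of_reach (show (openGraph ω).Reachable u c from hω), sub_self])]
        simp
      show 0 ≤ CSH.cshMarg _ _ o v (PS X)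
      rw [hzero]
      simp only [CSH.cshMarg]
      rw [show (fun _ : Fin n => (0 : ℝ)) = (0 : Fin n → ℝ) from rfl, CSH.slForm_zero]
      simp
    -- step: peel some `k ∈ X`, `k ≠ c`
    obtain ⟨k, hk⟩ := hne
    have hkc : k ≠ c := (Finset.mem_erase.1 hk).1
    have hkX : k ∈ X := (Finset.mem_erase.1 hk).2
    set X' : Finset (Fin n) := X.erase k with hX'
    have hXcard : X'.card < N := by
      rw [hX', Finset.card_erase_of_mem hkX]; have := Finset.card_pos.2 ⟨k, hkX⟩; omega
    have hX'X : ∀ a ∈ X', a ∈ X := fun a ha => Finset.mem_of_mem_erase ha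
    have hkX' : k ∉ X' := Finset.notMem_erase k X
    have hcX' : c ∈ X' := Finset.mem_erase.2 ⟨hkc.symm, hcX⟩
    have hko : o ≠ k := fun h => hoX (h ▸ hkX)
    have hkv : v ≠ k := fun h => hvX (h ▸ hkX)
    have hkD : k ∉ D := fun h => (hDX k h).1 hkX
    have hmk : ∫ ω, F (openCluster ω c) ∂μ ≤ ∫ ω, F (openCluster ω k) ∂μ := hcmin k hkX
    -- the objects
    set Dk : Set (BondConfig (Fin n)) := {ω : BondConfig (Fin n) | ∀ a ∈ (↑X' : Set (Fin n)), ¬ (openGraph ω).Reachable k a}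
      with hDk
    set gk : BondConfig (Fin n) → ℝ := fun ω => F (openCluster ω k) - F (openCluster ω c) with hgk
    set L := decoyListμ μ (↑X : Set (Fin n)) D with hL
    set p : ℝ := obsConstμ μ o v ((↑X : Set (Fin n)) ∪ {d | d ∈ D}) with hp
    set ck : Fin n → ℝ := avoidConstμ μ k (↑X' : Set (Fin n)) with hck
    -- the projected monotone functional of the peeled relay (benchmark `c`), from the projection hypothesis
    obtain ⟨g, hg_anti, hg_tower⟩ := htower c k F hF
    set Gk : Set (Sym2 (Fin n)) → ℝ := fun K => F {z | z = k ∨ ∃ e ∈ K, z ∈ e} - g K with hGk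
    have hGk_mono : Monotone Gk := fun _ _ hKK' => sub_le_sub (monotone_clusterFun k F hF hKK') (hg_anti hKK')
    have hproj : ∀ 𝒮 : Set (Set (Sym2 (Fin n))),
        ∫ ω in {ω : BondConfig (Fin n) | ¬ (openGraph ω).Reachable k c} ∩ {ω | openEdgeCluster ω k ∈ 𝒮}, gk ω ∂μ =
          ∫ ω in {ω : BondConfig (Fin n) | ¬ (openGraph ω).Reachable k c} ∩ {ω | openEdgeCluster ω k ∈ 𝒮}, Gk (openEdgeCluster ω k) ∂μ := by
      intro 𝒮
      simp only [hgk, hGk]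
      rw [integral_sub (hint _).integrableOn (hint _).integrableOn, integral_sub (hint _).integrableOn (hint _).integrableOn,
        hg_tower 𝒮]
      simp only [clusterFun_openEdgeCluster]
    set Tk : Fin n → ℝ := fun u => ∫ ω in Dk ∩ openConn k u, gk ω ∂μ with hTk
    set J : ℝ := ∫ ω in Dk, gk ω ∂μ with hJ
    -- positivity of the conditioning events (full support)
    have hempty_Dk : (∅ : BondConfig (Fin n)) ∈ Dk := by
      intro a ha h
      rw [reachable_openGraph_empty_iff] at h
      exact hkX' (h ▸ (Finset.mem_coe.1 ha))
    have hDkpos : 0 < μ.real Dk := hfull _ ⟨∅, hempty_Dk⟩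
    have hisopos : 0 < μ.real (Dk ∩ {ω | openEdgeCluster ω k = ∅}) :=
      hfull _ ⟨∅, hempty_Dk, subset_empty_iff.1 (openEdgeCluster_subset ∅ k)⟩
    -- set identities between the systems `(X; D)`, `(X'; k; D)` and `(X'; k :: D)`
    have hins : insert k (↑X' : Set (Fin n)) = ↑X := by
      rw [hX', Finset.coe_erase, insert_sdiff_singleton, insert_eq_of_mem (Finset.mem_coe.2 hkX)]
    have hset2 : (↑X' : Set (Fin n)) ∪ {d | d ∈ k :: D} = (↑X : Set (Fin n)) ∪ {d | d ∈ D} := by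
      ext a
      simp only [mem_union, Finset.mem_coe, hX', Finset.mem_erase, mem_setOf_eq, List.mem_cons]
      constructor
      · rintro (⟨_, ha⟩ | rfl | ha)
        · exact Or.inl ha
        · exact Or.inl hkX
        · exact Or.inr ha
      · rintro (ha | ha)
        · by_cases hak : a = k
          · exact Or.inr (Or.inl hak)
          · exact Or.inl ⟨hak, ha⟩
        · exact Or.inr (Or.inr ha)
    have hcshMargin : ∀ f : Set (Sym2 (Fin n)) → ℝ,
        cshMarginμ μ k (↑X' : Set (Fin n)) D o v f = CSH.cshMarg L p o v (covDμ μ k (↑X' : Set (Fin n)) f) := by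
      intro f
      rw [cshMarginμ, hins]
    have hnext : CSH.cshMarg (decoyListμ μ (↑X' : Set (Fin n)) (k :: D)) (obsConstμ μ o v ((↑X' : Set (Fin n)) ∪ {d | d ∈ k :: D})) o v
        (PS X') = CSH.cshMarg L p o v (PS X') - PS X' k * CSH.cshMarg L p o v ck := by
      rw [hset2, decoyListμ, hins, CSH.cshMarg_cons]
    -- (1) peel `k`
    have hpeel : PS X = PS X' + Tk := by
      funext u
      rw [Pi.add_apply]
      exact preSurplusμ_erase_add μ X F c k u hkX
    -- (2) tower: the peeled term and its total through the projected functional `Gk`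
    have hDk_S : ∀ u : Fin n, Dk ∩ openConn k u =
        {ω : BondConfig (Fin n) | ¬ (openGraph ω).Reachable k c} ∩
          {ω | openEdgeCluster ω k ∈ {K : Set (Sym2 (Fin n)) |
            (∀ a ∈ X', a ≠ c → ¬ (a = k ∨ ∃ e ∈ K, a ∈ e)) ∧ (u = k ∨ ∃ e ∈ K, u ∈ e)}} := by
      intro u; ext ω
      simp only [mem_inter_iff, hDk, mem_setOf_eq, Finset.mem_coe]
      constructor
      · rintro ⟨h1, h2⟩
        refine ⟨h1 c hcX', fun a ha _ => ?_, (reachable_iff_exists_mem_openEdgeCluster ω k u).1 h2⟩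
        rw [← reachable_iff_exists_mem_openEdgeCluster]; exact h1 a ha
      · rintro ⟨h1, h2, h3⟩
        refine ⟨fun a ha => ?_, (reachable_iff_exists_mem_openEdgeCluster ω k u).2 h3⟩
        by_cases hac : a = c
        · rw [hac]; exact h1
        · rw [reachable_iff_exists_mem_openEdgeCluster]; exact h2 a ha hac
    have hDk_0 : Dk = {ω : BondConfig (Fin n) | ¬ (openGraph ω).Reachable k c} ∩
          {ω | openEdgeCluster ω k ∈ {K : Set (Sym2 (Fin n)) | ∀ a ∈ X', a ≠ c → ¬ (a = k ∨ ∃ e ∈ K, a ∈ e)}} := by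
      ext ω
      simp only [mem_inter_iff, hDk, mem_setOf_eq, Finset.mem_coe]
      constructor
      · intro h1
        refine ⟨h1 c hcX', fun a ha _ => ?_⟩
        rw [← reachable_iff_exists_mem_openEdgeCluster]; exact h1 a ha
      · rintro ⟨h1, h2⟩ a ha
        by_cases hac : a = c
        · rw [hac]; exact h1
        · rw [reachable_iff_exists_mem_openEdgeCluster]; exact h2 a ha hac
    have towU : ∀ u : Fin n, Tk u = ∫ ω in Dk ∩ openConn k u, Gk (openEdgeCluster ω k) ∂μ := by
      intro u
      simp only [hTk]
      rw [hDk_S u]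
      exact hproj _
    have tow0 : J = ∫ ω in Dk, Gk (openEdgeCluster ω k) ∂μ := by
      simp only [hJ]
      rw [hDk_0]
      exact hproj _
    -- the total `J = (m_k − m_c) − Δ_k(X')`
    have hJtot : J = ((∫ ω, F (openCluster ω k) ∂μ) - ∫ ω, F (openCluster ω c) ∂μ) - PS X' k := by
      have h1 := integral_add_compl (hmeas Dk) (hint gk)
      have hDkc : Dkᶜ = ⋃ a' ∈ X', (openConn k a' : Set (BondConfig (Fin n))) := by
        ext ω
        rw [PreFKGSurplus.mem_iUnion_openConn, mem_compl_iff, hDk]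
        simp only [mem_setOf_eq, Finset.mem_coe, not_forall, not_not, exists_prop]
      have h2 : ∫ ω in Dkᶜ, gk ω ∂μ = PS X' k := by
        rw [hDkc]
      have h3 : ∫ ω, gk ω ∂μ = (∫ ω, F (openCluster ω k) ∂μ) - ∫ ω, F (openCluster ω c) ∂μ := by
        rw [hgk, integral_sub (hint _) (hint _)]
      rw [hJ]; linarith
    -- (2') the peeled term through `covDμ`
    have hTk_cov : (μ.real Dk) • Tk = covDμ μ k (↑X' : Set (Fin n)) Gk + J • ((μ.real Dk) • ck) := by
      funext u
      simp only [Pi.add_apply, Pi.smul_apply, smul_eq_mul]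
      have h2 : μ.real (Dk ∩ openConn k u) = μ.real Dk * ck u := by
        simp only [hck, avoidConstμ, hDk]
        rw [mul_div_cancel₀ _ (ne_of_gt hDkpos)]
      rw [towU u]
      unfold covDμ
      rw [← hDk, ← tow0, h2]
      ring
    -- (3) CSH for the peeled relay, functional `Gk`
    have hCSHk := hCSH k X' D hkX' hko hkv (fun h => hoX (hX'X o h)) (fun h => hvX (hX'X v h)) hD
      (fun d hd => ⟨fun h => hkD (h ▸ hd), fun h => (hDX d hd).1 (hX'X d h), (hDX d hd).2.1, (hDX d hd).2.2⟩)
    have h3 : 0 ≤ CSH.cshMarg L p o v (covDμ μ k (↑X' : Set (Fin n)) Gk) := by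
      rw [← hcshMargin]
      exact hCSHk Gk hGk_mono
    -- (4) Lemma AC: `Marg[c_k] ≥ 0` from CSH applied to `Ψ_iso`
    have h4 : 0 ≤ CSH.cshMarg L p o v ck := by
      have hiso := hCSHk CSH.psiIso CSH.psiIso_mono
      rw [hcshMargin] at hiso
      have hLk : ∀ dc ∈ L, dc.1 ≠ k := fun dc hdc h => hkD (h ▸ mem_decoyListμ μ _ D dc hdc)
      rw [CSH.cshMarg_congr L p o v (covDμ μ k (↑X' : Set (Fin n)) CSH.psiIso)
        ((μ.real (Dk ∩ {ω | openEdgeCluster ω k = ∅}) * μ.real Dk) • ck) (fun u => u ≠ k) hLk hko hkv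
        (fun u hu => by
          rw [covDμ_psiIso μ X' k u hu, Pi.smul_apply, smul_eq_mul]
          simp only [hck, avoidConstμ, hDk]
          rw [mul_assoc, mul_div_cancel₀ _ (ne_of_gt hDkpos)]), CSH.cshMarg_smul] at hiso
      exact (mul_nonneg_iff_of_pos_left (mul_pos hisopos hDkpos)).1 hiso
    -- (5) the replacement of Lemma κ: `J ≥ −Δ_k(X')` (only use of `m_c ≤ m_k`)
    have h5 : -PS X' k ≤ J := by rw [hJtot]; linarith [hmk]
    -- (6) the next rung by induction
    have h6 : 0 ≤ CSH.cshMarg (decoyListμ μ (↑X' : Set (Fin n)) (k :: D)) (obsConstμ μ o v ((↑X' : Set (Fin n)) ∪ {d | d ∈ k :: D})) o v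
        (PS X') :=
      ih X'.card hXcard X' c (k :: D) F rfl hF hcX' (fun a ha => hcmin a (hX'X a ha)) (fun h => hoX (hX'X o h)) (fun h => hvX (hX'X v h))
        (List.nodup_cons.2 ⟨hkD, hD⟩)
        (fun d hd => by
          rcases List.mem_cons.1 hd with rfl | hd
          · exact ⟨hkX', hko.symm, hkv.symm⟩
          · exact ⟨fun h => (hDX d hd).1 (hX'X d h), (hDX d hd).2.1, (hDX d hd).2.2⟩)
    -- (7) assemble
    have hmain : μ.real Dk * CSH.cshMarg L p o v (PS X) =
        μ.real Dk * CSH.cshMarg L p o v (PS X') + CSH.cshMarg L p o v (covDμ μ k (↑X' : Set (Fin n)) Gk) +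
          J * μ.real Dk * CSH.cshMarg L p o v ck := by
      have e1 : μ.real Dk * CSH.cshMarg L p o v Tk =
          CSH.cshMarg L p o v (covDμ μ k (↑X' : Set (Fin n)) Gk) + J * μ.real Dk * CSH.cshMarg L p o v ck := by
        rw [← CSH.cshMarg_smul, hTk_cov, CSH.cshMarg_add, CSH.cshMarg_smul, CSH.cshMarg_smul]; ring
      rw [hpeel, CSH.cshMarg_add, mul_add, e1]
      ring
    have hbound : μ.real Dk * CSH.cshMarg (decoyListμ μ (↑X' : Set (Fin n)) (k :: D))
        (obsConstμ μ o v ((↑X' : Set (Fin n)) ∪ {d | d ∈ k :: D})) o v (PS X') ≤ μ.real Dk * CSH.cshMarg L p o v (PS X) := by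
      rw [hmain, hnext]
      have := mul_le_mul_of_nonneg_right h5 (mul_nonneg hDkpos.le h4)
      nlinarith [h3, h4, this, hDkpos.le]
    show 0 ≤ CSH.cshMarg L p o v (PS X)
    exact le_of_mul_le_mul_left (by linarith [mul_nonneg hDkpos.le h6]) hDkpos
  intro X c D F hF hcX hcmin hoX hvX hD hDX
  exact main X.card X c D F rfl hF hcX hcmin hoX hvX hD hDX

end FK

end Summit.CriticalPhenomena.PercolationContinuityZ3.Theorems

end
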